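import Literature.Analysis.FunctionSpaces.PoincareWirtingerConvex
import Literature.Analysis.FunctionSpaces.PoincareGluing
import Mathlib.MeasureTheory.Function.LpSpace.Complete
import Mathlib.MeasureTheory.Function.LocallyIntegrable
import HarnessLib

/-!
# Letters for `PoincareLipschitzGradientLimitPotential`: Poincaré on balls with the unit-ball mean, pairings under `L²_loc` convergence

Helper file (K2 lane of crux `stmt-QuantumFields-19936` `HistoryTailL`, LINE 25 «CompactnessTransfer»,
the (TM)-discharge road «SU(2) currents ⇒ H-system ⇒ 8π quantum», brick (H) «planar stream
function», seam letter (H-lim)).  YM₃ on the unit 3-torus is rung R3 of the ladder — NOT `d = 4`,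
NOT infinite volume, NOT a mass gap, NOT the Clay problem; nothing here bears on those.

Pure analysis, generic in the dimension (`E` a finite-dimensional real normed space with an
additive Haar measure `μ`, `F` a complete real normed space):

* `eLpNorm_sub_ballAverage_le` — Poincaré–Wirtinger on the ball `B(0,R)` in `L²` form, from the
  tree's `Literature.Analysis.FunctionSpaces.lintegral_enorm_sub_setAverage_sq_le` (convex sets);
* `exists_eLpNorm_sub_unitBallAverage_le` — for every `R` a constant `K_R < ∞` with
  `‖G − ⨍_{B(0,1)} G‖_{L²(B(0,R))} ≤ K_R ‖DG‖_{L²(μ)}` for all `C¹` maps `G` (transfer of the mean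
  from `B(0, max R 1)` to `B(0,1)`, Maz'ya §1.1.11, via the tree's
  `Literature.Analysis.FunctionSpaces.enorm_setAverage_sub_setAverage_mul_rpow_le`);
* `exists_strictMono_le_half_pow` — a fast subsequence of a null sequence in `ℝ≥0∞`;
* `tendsto_integral_smul_of_tendsto_eLpNorm` — `∫ c • f n → ∫ c • g` for `c` continuous with
  compact support when `f n → g` in `L²(μ|B(0,R))` for every `R` (Hölder on the support ball and
  Mathlib's `tendsto_integral_of_L1`).

References: V. G. Maz'ya, *Sobolev Spaces* (1985), §1.1.11; L. C. Evans, *PDE* (2010), §5.8.1 Thm. 1.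
-/

noncomputable section

open MeasureTheory Set Filter Metric TopologicalSpace Module
open scoped ENNReal NNReal Topology

namespace Summit.QuantumFields.YangMills.Theorems.PoincareLipschitzGradientLimitPotential

open Literature.Analysis.FunctionSpaces

variable {E : Type*} [NormedAddCommGroup E] [NormedSpace ℝ E] [FiniteDimensional ℝ E]
  [MeasurableSpace E] [BorelSpace E]
variable {F : Type*} [NormedAddCommGroup F] [NormedSpace ℝ F] [CompleteSpace F]

/-! ## §1 Poincaré–Wirtinger on balls in `L²` form -/

omit [NormedSpace ℝ F] [CompleteSpace F] in
/-- `‖f‖_{L²(ν)} = (∫ ‖f‖²)^{1/2}` with a natural-number square inside. [folklore] -/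
theorem eLpNorm_two_eq_rpow {α : Type*} [MeasurableSpace α] (ν : Measure α) (f : α → F) :
    eLpNorm f 2 ν = (∫⁻ x, ‖f x‖ₑ ^ 2 ∂ν) ^ (1 / 2 : ℝ) := by
  rw [eLpNorm_eq_lintegral_rpow_enorm_toReal (by norm_num) (by norm_num)]
  simp only [ENNReal.toReal_ofNat, one_div]
  congr 1
  refine lintegral_congr fun x => ?_
  rw [show (2 : ℝ) = ((2 : ℕ) : ℝ) by norm_num, ENNReal.rpow_natCast]

variable (μ : Measure E) [μ.IsAddHaarMeasure]

omit [CompleteSpace F] in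
/-- A `C¹` map is integrable on every ball (continuous on the compact closed ball). [folklore] -/
theorem integrableOn_ball_of_contDiff {G : E → F} (hG : ContDiff ℝ 1 G) (x : E) (R : ℝ) :
    IntegrableOn G (ball x R) μ :=
  (hG.continuous.continuousOn.integrableOn_compact (isCompact_closedBall x R)).mono_set
    ball_subset_closedBall

/-- **Poincaré–Wirtinger on a ball, `L²` form**: for `G ∈ C¹` and `R > 0`,
`‖G − ⨍_{B(0,R)} G‖_{L²(B(0,R))} ≤ (2^{dim E} (2R)²)^{1/2} ‖DG‖_{L²(B(0,R))}`
(the tree's `lintegral_enorm_sub_setAverage_sq_le` on the convex set `B(0,R)` of diameter `≤ 2R`).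
[cite: Evans2010, §5.8.1 Thm. 1] -/
theorem eLpNorm_sub_ballAverage_le {G : E → F} (hG : ContDiff ℝ 1 G) {R : ℝ} (hR : 0 < R) :
    eLpNorm (fun x => G x - ⨍ y in ball (0 : E) R, G y ∂μ) 2 (μ.restrict (ball 0 R)) ≤
      ENNReal.ofReal (2 ^ finrank ℝ E * (2 * R) ^ 2) ^ (1 / 2 : ℝ) *
        eLpNorm (fderiv ℝ G) 2 (μ.restrict (ball 0 R)) := by
  have hQ0 : μ (ball (0 : E) R) ≠ 0 := (measure_ball_pos μ 0 hR).ne'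
  have hQt : μ (ball (0 : E) R) ≠ ⊤ := measure_ball_lt_top.ne
  have hD : ∀ y ∈ ball (0 : E) R, ∀ z ∈ ball (0 : E) R, ‖y - z‖ ≤ 2 * R := by
    intro y hy z hz
    rw [mem_ball_zero_iff] at hy hz
    calc ‖y - z‖ ≤ ‖y‖ + ‖z‖ := norm_sub_le y z
      _ ≤ 2 * R := by linarith
  have h := lintegral_enorm_sub_setAverage_sq_le μ hG (convex_ball (0 : E) R) measurableSet_ball
    hQ0 hQt (integrableOn_ball_of_contDiff μ hG 0 R) hD
  rw [eLpNorm_two_eq_rpow, eLpNorm_two_eq_rpow, ← ENNReal.mul_rpow_of_nonneg _ _ (by norm_num)]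
  exact ENNReal.rpow_le_rpow h (by norm_num)

/-- **Poincaré with the mean over the unit ball**: for every radius `R` there is `K < ∞` such that
for every `C¹` map `G`, `‖G − ⨍_{B(0,1)} G‖_{L²(B(0,R))} ≤ K ‖DG‖_{L²(μ)}` (Poincaré–Wirtinger on
`B(0, max R 1)` plus the transfer of the mean from the big ball to the unit ball, Maz'ya §1.1.11).
[cite: Mazja1985, §1.1.11 Lemma (proof)] -/
theorem exists_eLpNorm_sub_unitBallAverage_le (R : ℝ) :
    ∃ K : ℝ≥0∞, K ≠ ⊤ ∧ ∀ G : E → F, ContDiff ℝ 1 G →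
      eLpNorm (fun x => G x - ⨍ y in ball (0 : E) 1, G y ∂μ) 2 (μ.restrict (ball 0 R)) ≤
        K * eLpNorm (fderiv ℝ G) 2 μ := by
  -- work on the ball of radius `S = max R 1 ≥ 1`
  set S : ℝ := max R 1 with hS
  have hS1 : 1 ≤ S := le_max_right _ _
  have hS0 : 0 < S := zero_lt_one.trans_le hS1
  have hB1S : ball (0 : E) 1 ⊆ ball 0 S := ball_subset_ball hS1
  have hBRS : ball (0 : E) R ⊆ ball 0 S := ball_subset_ball (le_max_left _ _)
  have h10 : μ (ball (0 : E) 1) ≠ 0 := (measure_ball_pos μ 0 zero_lt_one).ne'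
  have h1t : μ (ball (0 : E) 1) ≠ ⊤ := measure_ball_lt_top.ne
  have hSt : μ (ball (0 : E) S) ≠ ⊤ := measure_ball_lt_top.ne
  set m : ℝ≥0∞ := μ (ball (0 : E) 1) ^ (1 / 2 : ℝ) with hm
  have hm0 : m ≠ 0 := by
    rw [hm]; exact ne_of_gt (ENNReal.rpow_pos (pos_iff_ne_zero.2 h10) h1t)
  have hmt : m ≠ ⊤ := by
    rw [hm]; exact ENNReal.rpow_ne_top_of_nonneg (by norm_num) h1t
  set C : ℝ≥0∞ := ENNReal.ofReal (2 ^ finrank ℝ E * (2 * S) ^ 2) ^ (1 / 2 : ℝ) with hC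
  have hCt : C ≠ ⊤ := ENNReal.rpow_ne_top_of_nonneg (by norm_num) ENNReal.ofReal_ne_top
  refine ⟨C * (1 + 3 * m⁻¹ * μ (ball (0 : E) S) ^ (1 / 2 : ℝ)), ?_, fun G hG => ?_⟩
  · refine ENNReal.mul_ne_top hCt (ENNReal.add_ne_top.2 ⟨ENNReal.one_ne_top, ?_⟩)
    exact ENNReal.mul_ne_top (ENNReal.mul_ne_top (by norm_num) (ENNReal.inv_ne_top.2 hm0))
      (ENNReal.rpow_ne_top_of_nonneg (by norm_num) hSt)
  -- notation
  set aS : F := ⨍ y in ball (0 : E) S, G y ∂μ with haS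
  set a1 : F := ⨍ y in ball (0 : E) 1, G y ∂μ with ha1
  set P : ℝ≥0∞ := eLpNorm (fun x => G x - aS) 2 (μ.restrict (ball 0 S)) with hP
  have hGc : Continuous G := hG.continuous
  have hGm : ∀ s : Set E, AEStronglyMeasurable G (μ.restrict s) := fun s =>
    hGc.aestronglyMeasurable.restrict
  have hle1S : μ.restrict (ball (0 : E) 1) ≤ μ.restrict (ball 0 S) := Measure.restrict_mono hB1S le_rfl
  have hleRS : μ.restrict (ball (0 : E) R) ≤ μ.restrict (ball 0 S) := Measure.restrict_mono hBRS le_rfl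
  -- (0) Poincaré–Wirtinger on `B(0,S)`
  have hPW : P ≤ C * eLpNorm (fderiv ℝ G) 2 μ :=
    (eLpNorm_sub_ballAverage_le μ hG hS0).trans
      (mul_le_mul' le_rfl (eLpNorm_mono_measure (fderiv ℝ G) Measure.restrict_le_self))
  -- (i) the unit-ball deviation from its own mean is at most twice the deviation from `aS`
  have h1 : eLpNorm (fun x => G x - a1) 2 (μ.restrict (ball 0 1)) ≤ 2 * P := by
    calc eLpNorm (fun x => G x - a1) 2 (μ.restrict (ball 0 1))
        ≤ 2 * eLpNorm (fun x => G x - aS) 2 (μ.restrict (ball 0 1)) :=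
          eLpNorm_sub_setAverage_le_two_mul h1t one_le_two (integrableOn_ball_of_contDiff μ hG 0 1) aS
      _ ≤ 2 * P := by
          rw [hP]; exact mul_le_mul' le_rfl (eLpNorm_mono_measure (fun x => G x - aS) hle1S)
  -- (ii) the two means are close
  have h2 : ‖aS - a1‖ₑ ≤ 3 * P * m⁻¹ := by
    have hVW : μ (ball (0 : E) S ∩ ball 0 1) ≠ 0 := by
      rwa [inter_eq_right.2 hB1S]
    have key := enorm_setAverage_sub_setAverage_mul_rpow_le (μ := μ) hVW one_le_two (hGm _) (hGm _)
    rw [inter_eq_right.2 hB1S, ENNReal.toReal_ofNat] at key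
    have key' : ‖aS - a1‖ₑ * m ≤ 3 * P := by
      calc ‖aS - a1‖ₑ * m ≤ P + eLpNorm (fun x => G x - a1) 2 (μ.restrict (ball 0 1)) := key
        _ ≤ P + 2 * P := add_le_add le_rfl h1
        _ = 3 * P := by ring
    calc ‖aS - a1‖ₑ = ‖aS - a1‖ₑ * m * m⁻¹ := by
          rw [mul_assoc, ENNReal.mul_inv_cancel hm0 hmt, mul_one]
      _ ≤ 3 * P * m⁻¹ := by gcongr
  -- (iii) triangle inequality on `B(0,S)`, then shrink to `B(0,R)`
  have h3 : eLpNorm (fun x => G x - a1) 2 (μ.restrict (ball 0 S)) ≤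
      P + ‖aS - a1‖ₑ * μ (ball (0 : E) S) ^ (1 / 2 : ℝ) := by
    have hsplit : (fun x => G x - a1) = (fun x => G x - aS) + fun _ => aS - a1 := by
      funext x; simp only [Pi.add_apply]; abel
    rw [hsplit]
    refine (eLpNorm_add_le ((hGm _).sub aestronglyMeasurable_const) aestronglyMeasurable_const
      one_le_two).trans ?_
    gcongr
    · exact le_rfl
    · rcases eq_or_ne (μ.restrict (ball (0 : E) S)) 0 with h0 | h0
      · simp [h0]
      · rw [eLpNorm_const _ (by norm_num) h0, Measure.restrict_apply_univ, ENNReal.toReal_ofNat]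
  calc eLpNorm (fun x => G x - a1) 2 (μ.restrict (ball 0 R))
      ≤ eLpNorm (fun x => G x - a1) 2 (μ.restrict (ball 0 S)) := eLpNorm_mono_measure _ hleRS
    _ ≤ P + 3 * P * m⁻¹ * μ (ball (0 : E) S) ^ (1 / 2 : ℝ) := h3.trans (by gcongr)
    _ = P * (1 + 3 * m⁻¹ * μ (ball (0 : E) S) ^ (1 / 2 : ℝ)) := by ring
    _ ≤ C * eLpNorm (fderiv ℝ G) 2 μ * (1 + 3 * m⁻¹ * μ (ball (0 : E) S) ^ (1 / 2 : ℝ)) := by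
        gcongr
    _ = C * (1 + 3 * m⁻¹ * μ (ball (0 : E) S) ^ (1 / 2 : ℝ)) * eLpNorm (fderiv ℝ G) 2 μ := by ring

/-! ## §2 Letters: a fast subsequence, local integrability from balls, pairings under `L²_loc` convergence -/

omit [CompleteSpace F] in
/-- The average of a difference is the difference of the averages (both integrable on `s`). [folklore] -/
theorem setAverage_sub {α : Type*} [MeasurableSpace α] {ν : Measure α} {s : Set α} {f g : α → F}
    (hf : IntegrableOn f s ν) (hg : IntegrableOn g s ν) :
    ⨍ x in s, (f x - g x) ∂ν = (⨍ x in s, f x ∂ν) - ⨍ x in s, g x ∂ν := by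
  rw [setAverage_eq, setAverage_eq, setAverage_eq, integral_sub hf hg, smul_sub]

omit [NormedSpace ℝ F] [CompleteSpace F] in
/-- From `δ n → 0` in `ℝ≥0∞`: a strictly increasing `φ : ℕ → ℕ` with `δ (φ k) ≤ 2⁻¹ ^ k`. [folklore] -/
theorem exists_strictMono_le_half_pow {δ : ℕ → ℝ≥0∞} (hδ : Tendsto δ atTop (𝓝 0)) :
    ∃ φ : ℕ → ℕ, StrictMono φ ∧ ∀ k, δ (φ k) ≤ 2⁻¹ ^ k := by
  have h : ∀ k : ℕ, ∃ N, ∀ n, N ≤ n → δ n ≤ 2⁻¹ ^ k := fun k =>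
    ENNReal.tendsto_atTop_zero.1 hδ _ (ENNReal.pow_pos (ENNReal.inv_pos.2 ENNReal.ofNat_ne_top) k)
  choose N hN using h
  refine ⟨fun k => (∑ i ∈ Finset.range (k + 1), N i) + k, ?_, fun k => hN k _ ?_⟩
  · intro k l hkl
    have : ∑ i ∈ Finset.range (k + 1), N i ≤ ∑ i ∈ Finset.range (l + 1), N i :=
      Finset.sum_le_sum_of_subset (Finset.range_mono (by omega))
    dsimp only
    omega
  · have : N k ≤ ∑ i ∈ Finset.range (k + 1), N i :=
      Finset.single_le_sum (f := N) (fun i _ => Nat.zero_le _) (Finset.mem_range.2 (Nat.lt_succ_self k))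
    show N k ≤ ∑ i ∈ Finset.range (k + 1), N i + k
    omega

omit [NormedSpace ℝ E] [FiniteDimensional ℝ E] [BorelSpace E] [NormedSpace ℝ F] [CompleteSpace F] in
/-- Integrability on every ball centred at `0` gives local integrability. [folklore] -/
theorem locallyIntegrable_of_integrableOn_ball {ν : Measure E} {f : E → F}
    (h : ∀ R : ℝ, IntegrableOn f (ball (0 : E) R) ν) : LocallyIntegrable f ν := by
  intro x
  refine ⟨ball 0 (‖x‖ + 1), isOpen_ball.mem_nhds ?_, h _⟩
  rw [mem_ball_zero_iff]
  linarith

omit [NormedSpace ℝ E] [FiniteDimensional ℝ E] [MeasurableSpace E] [BorelSpace E] in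
/-- A compactly supported function vanishes off some ball `B(0,R)`, `R > 0`. [folklore] -/
theorem exists_ball_of_hasCompactSupport {H : Type*} [Zero H] {c : E → H} (hcs : HasCompactSupport c) :
    ∃ R : ℝ, 0 < R ∧ ∀ x, x ∉ ball (0 : E) R → c x = 0 := by
  obtain ⟨r, hr⟩ := (isBounded_iff_subset_closedBall (0 : E)).1 hcs.isCompact.isBounded
  refine ⟨max r 0 + 1, by positivity, fun x hx => image_eq_zero_of_notMem_tsupport fun hx' => hx ?_⟩
  have := hr hx'
  rw [mem_closedBall_zero_iff] at this
  rw [mem_ball_zero_iff]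
  linarith [le_max_left r 0]

omit [CompleteSpace F] in
/-- **Pairings pass to the limit under `L²_loc` convergence**: if `c : E → ℝ` is continuous with
compact support, `f n`, `g` are locally integrable and `f n → g` in `L²(μ|B(0,R))` for every `R`,
then `∫ c • f n → ∫ c • g`. [folklore] -/
theorem tendsto_integral_smul_of_tendsto_eLpNorm {c : E → ℝ} (hc : Continuous c)
    (hcs : HasCompactSupport c) {f : ℕ → E → F} {g : E → F}
    (hf : ∀ n, LocallyIntegrable (f n) μ) (hg : LocallyIntegrable g μ)
    (h : ∀ R : ℝ, Tendsto (fun n => eLpNorm (f n - g) 2 (μ.restrict (ball 0 R))) atTop (𝓝 0)) :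
    Tendsto (fun n => ∫ x, c x • f n x ∂μ) atTop (𝓝 (∫ x, c x • g x ∂μ)) := by
  obtain ⟨R, hR, hR0⟩ := exists_ball_of_hasCompactSupport hcs
  obtain ⟨M, hM⟩ := hc.bounded_above_of_compact_support hcs
  have hνt : μ (ball (0 : E) R) ≠ ⊤ := measure_ball_lt_top.ne
  refine tendsto_integral_of_L1 _ (hc.aestronglyMeasurable.smul hg.aestronglyMeasurable)
    (Eventually.of_forall fun n => (hf n).integrable_smul_left_of_hasCompactSupport hc hcs) ?_
  -- `∫ ‖c • (f n - g)‖ ≤ M · μ(B_R)^{1/2} · ‖f n - g‖_{L²(B_R)}`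
  have hbound : ∀ n, ∫⁻ x, ‖c x • f n x - c x • g x‖ₑ ∂μ ≤
      ENNReal.ofReal M * (eLpNorm (f n - g) 2 (μ.restrict (ball 0 R)) *
        μ (ball (0 : E) R) ^ (1 / 2 : ℝ)) := by
    intro n
    have hpt : ∀ x, ‖c x • f n x - c x • g x‖ₑ ≤
        (ball (0 : E) R).indicator (fun x => ENNReal.ofReal M * ‖(f n - g) x‖ₑ) x := by
      intro x
      rw [← smul_sub, enorm_smul]
      by_cases hx : x ∈ ball (0 : E) R
      · rw [indicator_of_mem hx, Pi.sub_apply]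
        gcongr
        rw [← ofReal_norm]
        exact ENNReal.ofReal_le_ofReal (hM x)
      · rw [indicator_of_notMem hx, hR0 x hx]
        simp
    have hmeas : AEStronglyMeasurable (f n - g) (μ.restrict (ball 0 R)) :=
      ((hf n).aestronglyMeasurable.sub hg.aestronglyMeasurable).restrict
    calc ∫⁻ x, ‖c x • f n x - c x • g x‖ₑ ∂μ
        ≤ ∫⁻ x, (ball (0 : E) R).indicator (fun x => ENNReal.ofReal M * ‖(f n - g) x‖ₑ) x ∂μ :=
          lintegral_mono hpt
      _ = ENNReal.ofReal M * ∫⁻ x in ball (0 : E) R, ‖(f n - g) x‖ₑ ∂μ := by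
          rw [lintegral_indicator measurableSet_ball, lintegral_const_mul' _ _ ENNReal.ofReal_ne_top]
      _ = ENNReal.ofReal M * eLpNorm (f n - g) 1 (μ.restrict (ball 0 R)) := by
          rw [eLpNorm_one_eq_lintegral_enorm]
      _ ≤ ENNReal.ofReal M * (eLpNorm (f n - g) 2 (μ.restrict (ball 0 R)) *
            μ (ball (0 : E) R) ^ (1 / 2 : ℝ)) := by
          gcongr
          have key := eLpNorm_le_eLpNorm_mul_rpow_measure_univ one_le_two hmeas
          rw [Measure.restrict_apply_univ, ENNReal.toReal_one, ENNReal.toReal_ofNat] at key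
          norm_num at key
          exact key
  have h0 : Tendsto (fun n => ENNReal.ofReal M * (eLpNorm (f n - g) 2 (μ.restrict (ball 0 R)) *
      μ (ball (0 : E) R) ^ (1 / 2 : ℝ))) atTop (𝓝 0) := by
    have h1 : Tendsto (fun n => eLpNorm (f n - g) 2 (μ.restrict (ball 0 R)) *
        μ (ball (0 : E) R) ^ (1 / 2 : ℝ)) atTop (𝓝 (0 * μ (ball (0 : E) R) ^ (1 / 2 : ℝ))) :=
      ENNReal.Tendsto.mul_const (h R) (Or.inr (ENNReal.rpow_ne_top_of_nonneg (by norm_num) hνt))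
    rw [zero_mul] at h1
    have h2 := ENNReal.Tendsto.const_mul h1 (Or.inr ENNReal.ofReal_ne_top) (a := ENNReal.ofReal M)
    rwa [mul_zero] at h2
  exact tendsto_of_tendsto_of_tendsto_of_le_of_le tendsto_const_nhds h0 (fun _ => zero_le) hbound

end Summit.QuantumFields.YangMills.Theorems.PoincareLipschitzGradientLimitPotential

end
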